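import Summits.QuantumFields.YangMills.Theorems.BalabanUVNodesN15KingModelHeatKernelGradientGreenPowerLaw
import Summits.QuantumFields.YangMills.Theorems.BalabanUVNodesN15KingModelHeatKernelFreeKernelPowerLaw
import HarnessLib

/-!
# BalabanUVNodes ∕ N15 — THE KING-MODEL RUNG (PART ∇-h): THE MASS-UNIFORM INVERSE-CUBE LAW FOR THE GRADIENT OF THE FREE RESOLVENT KERNEL ON `ℤ⁴` —
# `c·|K_∞(z + e_ν) − K_∞(z)| ≤ 4940000∕(1 + |z_μ|)³` for every `c > 0`, `m² > 0`, `z ∈ ℤ⁴`, every pair of coordinates `μ, ν`; hence `≤ 4940000∕(1 + |z|_∞)³`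
# (the thermodynamic limit of PART ∇-f: on `ℤ⁴` there is no zero mode to begin with, and the constant carries no trace of the mass)
# (Track A, DAG node N15 = NE2; FAN-OUT v1.1 §N15 s3 «KING-MODEL RUNG … + what the curved case adds»; count-neutral)

HONEST FRAMING.  Count-neutral (cell `pub-ymgap`, seat `pub-ymgap-dag-n15-e` g57; `--supports stmt-QuantumFields-27247 --as helper` = K3ᴬ).  The free massive resolvent kernel
`K_∞ = (c(−Δ)+m²)⁻¹(z,0)` on `ℤ⁴` (Ε-a `freeKer`), the infinite-volume template behind King's torus covariance ([King1986] (4.4) p.670; [Balaban1983RegularityDecay] (2.43) p.584); no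
blocks, no background field.  PART Ϣ-k gave `c|K_∞(z)| ≤ 34016∕(1+z_ν²)`; this file differences it: the lattice gradient of the four-dimensional kernel decays like the inverse CUBE of the
sup-norm, with an absolute constant — uniformly over all masses `m² > 0` and all hoppings `c > 0` (by Ε-h's monotonicity in the mass this is equally a statement about the massless limit,
where `∇(4π²|x|²)⁻¹ ∼ |x|⁻³` is the continuum law).  THE MECHANISM: PART ∇-f on the cube tori `(ℤ∕(N+1))⁴` at the sites `z mod (N+1)` and `(z+e_ν) mod (N+1) = (z mod (N+1)) + e_ν`
(★ `cubePt_add_single`), for `2|z_μ| < N+1` so that the centred representative of `z_μ` is `z_μ` (Ϣ-k `valMinAbs_cubePt_eq`), and the thermodynamic limit Ε-f `tendsto_lapF_inv_cube` of BOTH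
kernel values (`le_of_tendsto_of_tendsto`; the right-hand side does not depend on `N` at all — PART ∇-f has no zero-mode term).
CONTENTS.  ★ `cubePt_add_single`; ★ `mul_abs_lapF_inv_cube_grad_le` (the finite-volume bound at the lattice site); ★★★★ **`mul_abs_freeKer_grad_le_powerLaw`** (every `μ, ν`); ★★★
**`mul_abs_freeKer_grad_le_powerLaw_supNorm`** (`≤ 4940000∕(1 + max_μ|z_μ|)³`); ★★ `abs_freeKer_grad_le_of_massless_scale` (the `c = 1` reading: `|∇K_∞(z)| ≤ 4940000∕(1+|z|_∞)³` for every `m² > 0`).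
PRIOR TREE ART (by name): PART ∇-f `mul_abs_lapF_inv_grad_le_powerLaw`; Ϣ-k `valMinAbs_cubePt_eq`; Ε-f `cubePt` ∕ `tendsto_lapF_inv_cube`; Ε-a `freeKer`; Mathlib `le_of_tendsto_of_tendsto`.
Dedup (rg at filing): basename 0 files; needles `mul_abs_freeKer_grad_le|cubePt_add_single|mul_abs_lapF_inv_cube_grad_le` 0 tree files.
Locators: [King1986] (4.4) p.670, (2.13) p.653, (3.63) p.663; [Balaban1983RegularityDecay] (2.43) p.584; [Balaban1984PropagatorsI] p.36 l.20–23; [LawlerLimic2010] Thm 4.3.1 (`∇G ≍ |x|^{1−d}`,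
`d = 4`, upper bound).  0 `sorry`, 0 `def`.
-/

noncomputable section

open Real Set Finset Filter
open scoped BigOperators Topology

namespace Summit.QuantumFields.YangMills.BalabanUVNodes.N15KingModelRung.HeatKernel

open Literature.MathematicalPhysics.QuantumFieldTheory.Balaban1983to89.B5Prop11Plancherel (Tor unitVec)
open Literature.MathematicalPhysics.QuantumFieldTheory.Balaban1983to89.Beta.WoodburyFibre (cM)
open Literature.MathematicalPhysics.QuantumFieldTheory.King1986.Torus (lapF)
open Summit.QuantumFields.YangMills.BalabanUVNodes.N15KingModelRung.TorusSpectral (freeKer cubePt tendsto_lapF_inv_cube)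

variable {c m2 : ℝ}

/-- ★ `(z mod (N+1)) + e_ν = (z + e_ν) mod (N+1)` on the cube torus. [folklore] -/
theorem cubePt_add_single (N : ℕ) (z : Fin 4 → ℤ) (ν : Fin 4) :
    cubePt N z + unitVec (fun _ : Fin 4 => N + 1) ν = cubePt N (z + Pi.single ν 1) := by
  funext μ
  unfold cubePt unitVec
  rw [Pi.add_apply, Pi.add_apply]
  by_cases h : μ = ν
  · subst h; simp
  · simp [Pi.single_eq_of_ne h]

/-- ★ PART ∇-f on the cube torus `(ℤ∕(N+1))⁴` at the site `z mod (N+1)`, for `2|z_μ| < N+1`: `c·|G_N(z+e_ν,0) − G_N(z,0)| ≤ 4940000∕(1 + |z_μ|)³` — the right-hand side is independent of `N`.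
[cite: King1986, (4.4) p.670, (2.13) p.653, (3.63) p.663] -/
theorem mul_abs_lapF_inv_cube_grad_le (hc : 0 < c) (hm : 0 < m2) (z : Fin 4 → ℤ) (ν μ : Fin 4) {N : ℕ} (hz : 2 * |z μ| < (N : ℤ) + 1) :
    c * |(lapF (fun _ : Fin 4 => N + 1) c m2)⁻¹ (cubePt N (z + Pi.single ν 1)) 0 - (lapF (fun _ : Fin 4 => N + 1) c m2)⁻¹ (cubePt N z) 0|
      ≤ 4940000 / (1 + |((z μ : ℤ) : ℝ)|) ^ 3 := by
  have h := mul_abs_lapF_inv_grad_le_powerLaw (K₀ := N + 1) hc hm (cubePt N z) 0 ν μ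
  rw [cubePt_add_single] at h
  have hv : ((((cubePt N z - 0) μ).valMinAbs.natAbs : ℕ) : ℝ) = |((z μ : ℤ) : ℝ)| := by
    rw [Nat.cast_natAbs, Int.cast_abs, valMinAbs_cubePt_eq z μ hz]
  rw [hv] at h
  exact h

/-- ★★★★ **THE MASS-UNIFORM INVERSE-CUBE LAW FOR THE GRADIENT OF THE FREE RESOLVENT KERNEL ON `ℤ⁴`**: for every `c > 0`, `m² > 0`, `z ∈ ℤ⁴` and every pair of coordinates `μ, ν`,
`c·|K_∞(z + e_ν) − K_∞(z)| ≤ 4940000∕(1 + |z_μ|)³` — the thermodynamic limit of PART ∇-f at both sites (Ε-f `tendsto_lapF_inv_cube`); no zero mode, no mass, an absolute constant.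
[cite: King1986, (4.4) p.670, (2.13) p.653, (3.63) p.663; Balaban1983RegularityDecay, (2.43) p.584; LawlerLimic2010, Thm 4.3.1] -/
theorem mul_abs_freeKer_grad_le_powerLaw (hc : 0 < c) (hm : 0 < m2) (z : Fin 4 → ℤ) (ν μ : Fin 4) :
    c * |freeKer c m2 (z + Pi.single ν 1) - freeKer c m2 z| ≤ 4940000 / (1 + |((z μ : ℤ) : ℝ)|) ^ 3 := by
  have hlim1 := tendsto_lapF_inv_cube (d := 3) hc.le hm (z + Pi.single ν 1)
  have hlim0 := tendsto_lapF_inv_cube (d := 3) hc.le hm z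
  have hf : Tendsto (fun N : ℕ => c * |(lapF (fun _ : Fin 4 => N + 1) c m2)⁻¹ (cubePt N (z + Pi.single ν 1)) 0 - (lapF (fun _ : Fin 4 => N + 1) c m2)⁻¹ (cubePt N z) 0|)
      atTop (𝓝 (c * |freeKer c m2 (z + Pi.single ν 1) - freeKer c m2 z|)) :=
    ((hlim1.sub hlim0).abs).const_mul c
  have hg : Tendsto (fun _ : ℕ => 4940000 / (1 + |((z μ : ℤ) : ℝ)|) ^ 3) atTop (𝓝 (4940000 / (1 + |((z μ : ℤ) : ℝ)|) ^ 3)) := tendsto_const_nhds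
  refine le_of_tendsto_of_tendsto hf hg ?_
  refine Filter.eventually_atTop.2 ⟨(2 * |z μ|).toNat, fun N hN => ?_⟩
  have hz : 2 * |z μ| < (N : ℤ) + 1 := by
    have : (2 * |z μ|) ≤ ((2 * |z μ|).toNat : ℤ) := Int.self_le_toNat _
    have hN' : ((2 * |z μ|).toNat : ℤ) ≤ N := by exact_mod_cast hN
    linarith
  exact mul_abs_lapF_inv_cube_grad_le hc hm z ν μ hz

/-- ★★★ **THE SUP-NORM FORM**: `c·|K_∞(z + e_ν) − K_∞(z)| ≤ 4940000∕(1 + max_μ|z_μ|)³` for every `c > 0`, `m² > 0`, `z ∈ ℤ⁴`, `ν` (the previous bound at the coordinate where `|z_μ|` is largest).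
[cite: King1986, (4.4) p.670, (3.63) p.663; Balaban1983RegularityDecay, (2.43) p.584; LawlerLimic2010, Thm 4.3.1] -/
theorem mul_abs_freeKer_grad_le_powerLaw_supNorm (hc : 0 < c) (hm : 0 < m2) (z : Fin 4 → ℤ) (ν : Fin 4) :
    c * |freeKer c m2 (z + Pi.single ν 1) - freeKer c m2 z| ≤ 4940000 / (1 + Finset.univ.sup' Finset.univ_nonempty (fun μ : Fin 4 => |((z μ : ℤ) : ℝ)|)) ^ 3 := by
  obtain ⟨μ, -, hμ⟩ := Finset.exists_mem_eq_sup' (Finset.univ_nonempty (α := Fin 4)) (fun μ : Fin 4 => |((z μ : ℤ) : ℝ)|)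
  rw [hμ]
  exact mul_abs_freeKer_grad_le_powerLaw hc hm z ν μ

/-- ★★ THE UNIT-HOPPING READING: at `c = 1`, for EVERY mass `m² > 0`, `|K_∞(z + e_ν) − K_∞(z)| ≤ 4940000∕(1 + max_μ|z_μ|)³` — the gradient of the massive lattice Green's function of `ℤ⁴` is bounded by the
massless inverse-cube law, uniformly in the mass. [cite: Balaban1983RegularityDecay, (2.43) p.584; LawlerLimic2010, Thm 4.3.1] -/
theorem abs_freeKer_grad_le_of_unit_hopping (hm : 0 < m2) (z : Fin 4 → ℤ) (ν : Fin 4) :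
    |freeKer 1 m2 (z + Pi.single ν 1) - freeKer 1 m2 z| ≤ 4940000 / (1 + Finset.univ.sup' Finset.univ_nonempty (fun μ : Fin 4 => |((z μ : ℤ) : ℝ)|)) ^ 3 := by
  have h := mul_abs_freeKer_grad_le_powerLaw_supNorm one_pos hm z ν
  rwa [one_mul] at h

end Summit.QuantumFields.YangMills.BalabanUVNodes.N15KingModelRung.HeatKernel

end
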